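import Mathlib
import Summits.Ventures.PercRepro.TriangleCapRowStair
import Summits.Ventures.PercRepro.TriangleCapRowWitnessValue
import Summits.Ventures.PercRepro.TriangleCapRowBandBound

/-!
# PercRepro — THE BAND `t` OF THE ROW `a` IS EXACTLY AN INTERVAL: THE CHERRY TABLE OF EVERY ROW `a ≥ 3` AT EVERY
LAYER (p3, gen 51; part 239)

With `ℓ = a − 1`, `q = ⌊t / ℓ⌋`, `ρ = t mod ℓ`, the threshold identity `ℓ q (q + 1) + ℓ q (q − 1) + 2 ρ q = 2 q t`
(`row_threshold`) makes the tangent-line bound of part 236 at `q` and the balanced collision count of part 238 the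
same number: the band `t` of the row `a` consists EXACTLY of the values `j` with

  **`2 j + 2 q t ≤ 2 t + t (t − 1) + (a − 1) q (q + 1)`**, i.e. `j ≤ t + C(t, 2) − (a − 1) C(q, 2) − ρ q`

(`cherry_row_band_exact`: membership by `cherry_row_band_bound`, attainment by the round-robin row witnesses
`row_band_attained`).  For `a ≥ t + 1` this is the full band `2 j ≤ t (t + 1)` (part 231); for `a ≤ t` the band is
truncated — the row `a = 2` keeps only `j ≤ t` of every band (`row_two_band_attained` / `bipSub_row_two_band_bound`
on the bipartite class).  Axioms: standard.
-/

namespace PercRepro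

namespace TriangleCap

namespace C047

open Finset

/-- **THE THRESHOLD IDENTITY:** `ℓ q (q + 1) + (ℓ q (q − 1) + 2 ρ q) = 2 q t` for `q = ⌊t / ℓ⌋`, `ρ = t mod ℓ`. -/
theorem row_threshold (ℓ t : ℕ) :
    ℓ * ((t / ℓ) * (t / ℓ + 1)) + (ℓ * ((t / ℓ) * (t / ℓ - 1)) + 2 * ((t % ℓ) * (t / ℓ))) = 2 * (t / ℓ) * t := by
  have hdiv := Nat.div_add_mod t ℓ
  obtain ⟨q, hq⟩ : ∃ q, t / ℓ = q := ⟨_, rfl⟩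
  obtain ⟨ρ, hρ⟩ : ∃ ρ, t % ℓ = ρ := ⟨_, rfl⟩
  rw [hq, hρ] at hdiv ⊢
  rw [← hdiv]
  rcases Nat.eq_zero_or_pos q with rfl | hq0
  · simp
  · obtain ⟨q', rfl⟩ : ∃ q', q = q' + 1 := ⟨q - 1, by omega⟩
    rw [Nat.add_sub_cancel]
    ring

/-- **EVERY VALUE OF THE TRUNCATED BAND IS ATTAINED** (`2 ≤ a`, `1 ≤ t`, `2 t ≤ r`, `a + r ≤ n`, `r + 1 ≤ n`,
`q = ⌊t / (a − 1)⌋`): for `2 j + 2 q t ≤ 2 t + t (t − 1) + (a − 1) q (q + 1)` a `K₄⁻`-free (indeed `a`-bipartite)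
graph on `Fin n` with `|E| + r = a (n − a)` at the gap `2 t (r − t − 1) + 2 j`. -/
theorem row_band_attained (n a r t j : ℕ) (ha : 2 ≤ a) (ht : 1 ≤ t) (hr : 2 * t ≤ r) (han : a + r ≤ n)
    (hn : r + 1 ≤ n)
    (hj : 2 * j + 2 * (t / (a - 1)) * t ≤ 2 * t + t * (t - 1) + (a - 1) * ((t / (a - 1)) * (t / (a - 1) + 1))) :
    ∃ (D : SimpleGraph (Fin n)) (_ : DecidableRel D.Adj), K4mFree D ∧ D.edgeFinset.card + r = a * (n - a) ∧
      ∑ v, deg D v * deg D v + r * (n - 1 - r) + (2 * (t * (r - t - 1)) + 2 * j) = D.edgeFinset.card * n := by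
  have hℓ : 1 ≤ a - 1 := by omega
  have hthr := row_threshold (a - 1) t
  have hcoll := coll_lfRR_zero (a - 1) t (by omega)
  have hj' : 2 * j + coll t (lfRR (a - 1) 0) ≤ 2 * t + t * (t - 1) := by omega
  obtain ⟨u, hu, m, hm, hjm⟩ := stair_attained (a - 1) t j hj'
  have hlf : ∀ i, i < t → 1 ≤ lfRR (a - 1) u i ∧ lfRR (a - 1) u i < a := fun i _ => by
    have := lfRR_bounds (a - 1) u i hℓ
    omega
  obtain ⟨hK, hE, hS⟩ := rowWitness_value n a r t m (lfRR (a - 1) u) ht hm hlf (by omega) (by omega) han hn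
  refine ⟨rowWitness n a r t m (by omega) (lfRR (a - 1) u), inferInstance, hK, hE, ?_⟩
  rw [hjm]
  exact hS

/-- **THE BAND `t` OF THE ROW `a` IS EXACTLY AN INTERVAL** (`3 ≤ a`, `1 ≤ t`, `4 t + 3 ≤ r`,
`2 r ≥ 4 t + 6 + t (t + 1)`, `a + t < r`, `2 a + r ≤ k` (`r + 7 ≤ k` at `a = 3`),
`2 t (r − t − 1) + t (t + 1) < stabGapFull k a r`; `q = ⌊t / (a − 1)⌋`): (i) every `K₄⁻`-free graph at the band value
`closed − (2 t (r − t − 1) + 2 j)` has `2 j + 2 q t ≤ 2 t + t (t − 1) + (a − 1) q (q + 1)`; (ii) every such `j` is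
attained. -/
theorem cherry_row_band_exact (k a r t : ℕ) (ha3 : 3 ≤ a) (ht : 1 ≤ t) (hr4 : 4 * t + 3 ≤ r)
    (hr : 4 * t + 6 + t * (t + 1) ≤ 2 * r) (hat : a + t < r) (hk : 2 * a + r ≤ k) (hk3 : a = 3 → r + 7 ≤ k)
    (hlt : 2 * (t * (r - t - 1)) + t * (t + 1) < stabGapFull k a r) :
    (∀ (D : SimpleGraph (Fin k)) [DecidableRel D.Adj], K4mFree D → D.edgeFinset.card + r = a * (k - a) →
        ∀ j, 2 * j ≤ t * (t + 1) →
        ∑ v, deg D v * deg D v + r * (k - 1 - r) + (2 * (t * (r - t - 1)) + 2 * j) = D.edgeFinset.card * k →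
        2 * j + 2 * (t / (a - 1)) * t ≤ 2 * t + t * (t - 1) + (a - 1) * ((t / (a - 1)) * (t / (a - 1) + 1))) ∧
      (∀ j, 2 * j + 2 * (t / (a - 1)) * t ≤ 2 * t + t * (t - 1) + (a - 1) * ((t / (a - 1)) * (t / (a - 1) + 1)) →
        ∃ (D : SimpleGraph (Fin k)) (_ : DecidableRel D.Adj), K4mFree D ∧ D.edgeFinset.card + r = a * (k - a) ∧
          ∑ v, deg D v * deg D v + r * (k - 1 - r) + (2 * (t * (r - t - 1)) + 2 * j) =
            D.edgeFinset.card * k) := by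
  refine ⟨?_, ?_⟩
  · intro D _ hK hm j hj heq
    exact cherry_row_band_bound k a r t ha3 ht hr4 hr hat hk hk3 hlt j hj D hK hm heq (t / (a - 1))
  · intro j hj
    exact row_band_attained k a r t j (by omega) ht (by omega) (by omega) (by omega) hj

/-- **THE ROW `a = 2`, BIPARTITE CLASS, MEMBERSHIP** (`2 + t < r`, `r + 1 ≤ k`): a `2`-bipartite graph whose
missing graph has a vertex of degree `r − t` at the band value `2 t (r − t − 1) + 2 j` has `j ≤ t` — the band keeps
only its top `t + 1` values. -/
theorem bipSub_row_two_band_bound (k r t j : ℕ) (hat : 2 + t < r) (hk : r + 1 ≤ k) (D : SimpleGraph (Fin k))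
    [DecidableRel D.Adj] (A : Finset (Fin k)) (hA : A.card = 2) (hB : BipSub D A)
    (hm : D.edgeFinset.card + r = 2 * (k - 2)) (w : Fin k) (hw : deg (missingGraph D A) w + t = r)
    (heq : ∑ v, deg D v * deg D v + r * (k - 1 - r) + (2 * (t * (r - t - 1)) + 2 * j) = D.edgeFinset.card * k) :
    j ≤ t := by
  have hwA : w ∈ A := by
    by_contra hwA
    have h1 := deg_add_deg_missingGraph D A hB w
    rw [if_neg hwA, hA] at h1
    omega
  have h := row_band_bound k 2 r t j hk D A hA hB hm w hwA hw (by omega) heq t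
  rw [show (2 : ℕ) - 1 = 1 from rfl, one_mul] at h
  rcases Nat.eq_zero_or_pos t with rfl | hpos
  · omega
  · obtain ⟨t', rfl⟩ : ∃ t', t = t' + 1 := ⟨t - 1, by omega⟩
    rw [Nat.add_sub_cancel] at h
    nlinarith

/-- **THE ROW `a = 2`, ATTAINMENT** (`1 ≤ t`, `2 t ≤ r`, `2 + r ≤ n`, `r + 1 ≤ n`): every `j ≤ t` is attained on the
row `2`. -/
theorem row_two_band_attained (n r t j : ℕ) (ht : 1 ≤ t) (hr : 2 * t ≤ r) (han : 2 + r ≤ n) (hn : r + 1 ≤ n)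
    (hj : j ≤ t) :
    ∃ (D : SimpleGraph (Fin n)) (_ : DecidableRel D.Adj), K4mFree D ∧ D.edgeFinset.card + r = 2 * (n - 2) ∧
      ∑ v, deg D v * deg D v + r * (n - 1 - r) + (2 * (t * (r - t - 1)) + 2 * j) = D.edgeFinset.card * n := by
  have key : 2 * j + 2 * (t / (2 - 1)) * t ≤ 2 * t + t * (t - 1) + (2 - 1) * ((t / (2 - 1)) * (t / (2 - 1) + 1)) := by
    rw [show (2 : ℕ) - 1 = 1 from rfl, Nat.div_one, one_mul]
    obtain ⟨t', rfl⟩ : ∃ t', t = t' + 1 := ⟨t - 1, by omega⟩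
    rw [Nat.add_sub_cancel]
    nlinarith
  exact row_band_attained n 2 r t j le_rfl ht hr han hn key

end C047

end TriangleCap

end PercRepro
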